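import Summits.ValiantsHypothesis.ValiantsHypothesis.Theorems.LacunarySymmetroidMatrixDescartesDoorA26WallBubblingOrderThreeOpening

/-!
# `DoorA26` / line `wall_bubbling` — THE TRANSVERSAL CASE OF ORDER ≤ 3: jet surjectivity lifts every profile of order ≤ 3

HONEST FRAMING.  Object-search cell `pub-symmetroid`, crux `Theses.LacunarySymmetroid.DoorA26` (stmt-ValiantsHypothesis-19979; OPEN, typed,
never asserted).  W2 seat val-sym-door-p1 g20, file #84; def-free helper for obligation (R) of `Cruxes/DoorA26/Lines/wall_bubbling.lean`.
Imports #80 `…OrderThreeOpening`.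

THE THEOREM (`mem_twentyLocus_of_orderThree_jetSurjective`).  LEVEL 0 of the obstruction tower (memo `DOOR-A26-P1G20-NEWTON-LIFT.md` §2) for patterns
`(3^a, 2^b, 1^c)`: if the JET MAP of the first variation at the multiple zeros — `w ↦ (c₁(w)(z_j))_{m_j ≥ 2} × (c₁(w)′(z_j))_{m_j = 3}` on the 18 shift
coordinates — is ONTO (transversality of the realisable variety to the multiplicity stratum), then `δ ∈ TwentyLocus`: prescribe `c₁(z_j) = −F″(z_j)` at
the touches, `c₁(z_j) = 0` and `c₁′(z_j) = −F‴(z_j)` at the triple zeros, and apply #80.  (For orders ≤ 3 the family `S + ηT` suffices; higher orders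
need the polynomial families of #83 and a triangular solve, memo §4.)

WHAT IS HERE.  ★ `mem_twentyLocus_of_orderThree_jetSurjective`.  Nothing here bears on `DoorA26`, `DoorA34`, (W)/(M)/(R), `MatrixDescartes` (18050)
or `VP ≠ VNP`; registers unchanged.

[this work] the corollary.
-/

set_option linter.dupNamespace false

namespace Summit.ValiantsHypothesis.ValiantsHypothesis.Theorems.LacunarySymmetroidMatrixDescartes.WallBubbling

open Finset Filter Topology
open Bubbling (TwentyLocus expSum)

/-- ★ **JET SURJECTIVITY LIFTS EVERY PROFILE OF ORDER ≤ 3.**  Exact orders `m_j ∈ {1,2,3}` at separated points with `Σ m_j ≥ 20`; if every pair of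
targets (values of the first variation at the zeros of order `≥ 2`, slopes at the zeros of order `3`) is attained by some coordinate shift `w`, then
`δ ∈ TwentyLocus`. [this work] -/
theorem mem_twentyLocus_of_orderThree_jetSurjective (δ : Fin 6 → ℝ) (S : Fin 6 → Matrix (Fin 2) (Fin 2) ℝ) (hS : ∀ l, (S l).IsSymm)
    {r : ℕ} (z : Fin r → ℝ) {ρ : ℝ} (hρ : 0 < ρ) (hsep : ∀ i j : Fin r, i < j → z i + ρ ≤ z j - ρ)
    (m : Fin r → ℕ) (hm1 : ∀ j, 1 ≤ m j) (hm3 : ∀ j, m j ≤ 3) (hm : 20 ≤ ∑ j, m j)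
    (hvan : ∀ j, ∀ i < m j, iteratedDeriv i (fun t => (∑ l, Real.exp (δ l * t) • S l).det) (z j) = 0)
    (htop : ∀ j, iteratedDeriv (m j) (fun t => (∑ l, Real.exp (δ l * t) • S l).det) (z j) ≠ 0)
    (hJ : ∀ v v' : Fin r → ℝ, ∃ w : Fin 6 → Fin 3 → ℝ,
      (∀ j, 2 ≤ m j →
        (((∑ l, Real.exp (δ l * z j) • S l) + (∑ l, Real.exp (δ l * z j) • (!![w l 0, w l 1; w l 1, w l 2] : Matrix (Fin 2) (Fin 2) ℝ))).det
          - (∑ l, Real.exp (δ l * z j) • S l).det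
          - (∑ l, Real.exp (δ l * z j) • (!![w l 0, w l 1; w l 1, w l 2] : Matrix (Fin 2) (Fin 2) ℝ)).det) = v j) ∧
      (∀ j, m j = 3 →
        deriv (fun t => ((∑ l, Real.exp (δ l * t) • S l) + (∑ l, Real.exp (δ l * t) • (!![w l 0, w l 1; w l 1, w l 2] : Matrix (Fin 2) (Fin 2) ℝ))).det
          - (∑ l, Real.exp (δ l * t) • S l).det
          - (∑ l, Real.exp (δ l * t) • (!![w l 0, w l 1; w l 1, w l 2] : Matrix (Fin 2) (Fin 2) ℝ)).det) (z j) = v' j)) :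
    δ ∈ TwentyLocus := by
  set F : ℝ → ℝ := fun t => (∑ l, Real.exp (δ l * t) • S l).det with hF
  -- targets: `−F″(z_j)` at the touches, `0` at the triple zeros; slopes `−F‴(z_j)`
  obtain ⟨w, hw0, hw1⟩ := hJ (fun j => if m j = 2 then -iteratedDeriv 2 F (z j) else 0) (fun j => -iteratedDeriv 3 F (z j))
  refine mem_twentyLocus_of_orderThree_pushes δ S hS z hρ hsep m hm1 hm3 hm hvan htop w ?_ ?_ ?_
  · intro j hj
    have h := hw0 j (by omega)
    rw [h]
    simp only [hj, if_true]
    have hne : iteratedDeriv 2 F (z j) ≠ 0 := by have := htop j; rwa [hj] at this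
    nlinarith [mul_self_pos.2 hne]
  · intro j hj
    have h := hw0 j (by omega)
    rw [h]
    simp only [hj, show (3 : ℕ) ≠ 2 by norm_num, if_false]
  · intro j hj
    have h := hw1 j hj
    rw [h]
    have hne : iteratedDeriv 3 F (z j) ≠ 0 := by have := htop j; rwa [hj] at this
    nlinarith [mul_self_pos.2 hne]

end Summit.ValiantsHypothesis.ValiantsHypothesis.Theorems.LacunarySymmetroidMatrixDescartes.WallBubbling
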